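import Literature.MathematicalPhysics.QuantumLattice.HubbardCouplingWeights
import Mathlib.Analysis.Convex.SpecificFunctions.Basic
import HarnessLib

/-!
# Trace of a word of matrices as a sum over closed paths; the AM–GM word bound

HONEST FRAMING: ladder R1–R4 with certified numbers; no claim on H/H₀; bounds for model classes,
no materials claim.

Cell `pub-hubbard`, bounds chapter (Theorem 12 of `paper/bounds.tex`, Lemma 12.2 = the activity
bound with the HÖLDER weight `e^{|c_b|} - 1` per bond). This file is model-free linear algebra:

* `sum_mul_listProd_mul_eq`, `trace_listProd_ofFn` — the entries / the trace of an ordered product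
  `M₀ M₁ ⋯ M_{N-1}` as a sum over paths / closed paths of products of entries [folklore];
* `subStoch` — the set of entrywise nonnegative real matrices with row sums `≤ 1` (closed under products;
  diagonal entries `≤ 1`) [folklore];
* `trace_listProd_le_of_mem_subStoch` — `Tr (S₀ ⋯ S_{i-1} (D_w Y) S_{i+1} ⋯) ≤ Σ_s w_s` for
  substochastic `S_k, Y` and a nonnegative diagonal weight `D_w` in ONE slot (cyclicity) [folklore];
* `norm_trace_listProd_diagExp_mul_le` — **the AM–GM word bound**: for real `d` and complex
  matrices `X₀, …, X_{N-1}` whose entrywise moduli are substochastic,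
  `|Tr ∏_k (diag(e^{d/N}) X_k)| ≤ Σ_s e^{d_s}` (Jensen for `exp` on every closed path, then the
  one-slot bound for each of the `N` positions). This replaces the Schatten–Hölder inequality in
  the proof of Lemma 12.2 (Ueltschi, arXiv:cond-mat/9903335, §2.3) for DIAGONAL Gibbs weights and
  signed-partial-permutation hopping letters. [folklore; this file]

## Mathlib / tree search

Mathlib: `Matrix.mul_apply`, `Matrix.trace`, `Matrix.trace_mul_comm`, `Fin.consEquiv`,
`Fin.prod_univ_succ`, `List.ofFn_succ`, `List.drop_eq_getElem_cons`, `ConvexOn.map_sum_le`,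
`convexOn_exp`, `Real.exp_sum`; no path-sum formula for `List.prod` of matrices in Mathlib
(`rg "ofFn.*prod.*apply"`: nothing). Tree: `trace_prod_rotate` (MPS file; `Fin D` only) — not
imported, the one-slot bound below uses `take/drop` instead.
-/

noncomputable section

namespace Summit.HubbardSuperconductivity.HubbardLadder.Bounds

open Matrix Finset

/-! ### Entries and trace of an ordered product as path sums -/

section PathSum

variable {n : Type*} [Fintype n] [DecidableEq n] {R : Type*} [CommRing R]

/-- The weight of the path `σ₀ → σ₁ → ⋯ → σ_N` under the word `M₀, …, M_{N-1}`:
`∏_k M_k(σ_k, σ_{k+1})`. [folklore] -/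
def pathWt {N : ℕ} (M : Fin N → Matrix n n R) (σ : Fin (N + 1) → n) : R :=
  ∏ k : Fin N, M k (σ k.castSucc) (σ k.succ)

omit [Fintype n] [DecidableEq n] in
/-- Auxiliary lemma `pathWt_cons` (support step for the results of this file; see the module docstring). -/
theorem pathWt_cons {N : ℕ} (M : Fin (N + 1) → Matrix n n R) (a : n) (σ : Fin (N + 1) → n) :
    pathWt M (Fin.cons a σ : Fin (N + 2) → n) = M 0 a (σ 0) * pathWt (fun k => M k.succ) σ := by
  unfold pathWt
  rw [Fin.prod_univ_succ]
  simp only [Fin.castSucc_zero, Fin.cons_zero, Fin.cons_succ, ← Fin.succ_castSucc]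

/-- **Bilinear path-sum formula**: `Σ_{s,t} u_s (M₀ ⋯ M_{N-1})_{st} v_t = Σ_σ u_{σ₀} (∏_k M_k(σ_k,σ_{k+1})) v_{σ_N}`.
[folklore] -/
theorem sum_mul_listProd_mul_eq {N : ℕ} (M : Fin N → Matrix n n R) (u v : n → R) :
    ∑ s, ∑ t, u s * (List.ofFn M).prod s t * v t =
      ∑ σ : Fin (N + 1) → n, u (σ 0) * pathWt M σ * v (σ (Fin.last N)) := by
  induction N generalizing u with
  | zero =>
    simp only [List.ofFn_zero, List.prod_nil, pathWt, Finset.univ_eq_empty, Finset.prod_empty,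
      mul_one]
    rw [Fintype.sum_equiv (Equiv.funUnique (Fin 1) n)
      (fun σ : Fin 1 → n => u (σ 0) * v (σ (Fin.last 0))) (fun s => u s * v s) (fun σ => rfl)]
    refine Finset.sum_congr rfl fun s _ => ?_
    simp only [Matrix.one_apply, mul_ite, mul_one, mul_zero, ite_mul, zero_mul, Finset.sum_ite_eq,
      Finset.mem_univ, if_true]
  | succ N ih =>
    rw [List.ofFn_succ, List.prod_cons]
    have hL : ∑ s, ∑ t, u s * (M 0 * (List.ofFn fun i : Fin N => M i.succ).prod) s t * v t =
        ∑ r, ∑ t, (∑ s, u s * M 0 s r) * (List.ofFn fun i : Fin N => M i.succ).prod r t * v t := by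
      simp only [Matrix.mul_apply, Finset.mul_sum, Finset.sum_mul]
      calc ∑ s, ∑ t, ∑ r, u s * (M 0 s r * (List.ofFn fun i : Fin N => M i.succ).prod r t) * v t
          = ∑ s, ∑ r, ∑ t, u s * M 0 s r * (List.ofFn fun i : Fin N => M i.succ).prod r t * v t := by
            refine Finset.sum_congr rfl fun s _ => ?_
            rw [Finset.sum_comm]
            exact Finset.sum_congr rfl fun r _ => Finset.sum_congr rfl fun t _ => by ring
        _ = ∑ r, ∑ s, ∑ t, u s * M 0 s r * (List.ofFn fun i : Fin N => M i.succ).prod r t * v t :=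
            Finset.sum_comm
        _ = ∑ r, ∑ t, ∑ s, u s * M 0 s r * (List.ofFn fun i : Fin N => M i.succ).prod r t * v t :=
            Finset.sum_congr rfl fun r _ => Finset.sum_comm
    rw [hL, ih (fun i => M i.succ) fun r => ∑ s, u s * M 0 s r]
    rw [Fintype.sum_equiv (Fin.consEquiv fun _ : Fin (N + 2) => n).symm
      (fun σ : Fin (N + 2) → n => u (σ 0) * pathWt M σ * v (σ (Fin.last (N + 1))))
      (fun p => u p.1 * pathWt M (Fin.cons p.1 p.2) *
        v ((Fin.cons p.1 p.2 : Fin (N + 2) → n) (Fin.last (N + 1))))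
      (fun σ => by
        rw [show (Fin.consEquiv fun _ : Fin (N + 2) => n).symm σ = (σ 0, Fin.tail σ) from rfl,
          Fin.cons_self_tail]),
      Fintype.sum_prod_type, Finset.sum_comm]
    refine Finset.sum_congr rfl fun σ _ => ?_
    rw [Finset.sum_mul, Finset.sum_mul]
    refine Finset.sum_congr rfl fun a _ => ?_
    have hlast : (Fin.cons a σ : Fin (N + 2) → n) (Fin.last (N + 1)) = σ (Fin.last N) := by
      rw [← Fin.succ_last, Fin.cons_succ]
    dsimp only
    rw [pathWt_cons, hlast]
    ring

/-- **Trace of a word as a sum over closed paths**: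
`Tr (M₀ ⋯ M_{N-1}) = Σ_{σ : σ₀ = σ_N} ∏_k M_k(σ_k, σ_{k+1})`. [folklore] -/
theorem trace_listProd_ofFn {N : ℕ} (M : Fin N → Matrix n n R) :
    ((List.ofFn M).prod).trace =
      ∑ σ : Fin (N + 1) → n, if σ 0 = σ (Fin.last N) then pathWt M σ else 0 := by
  have h : ∀ s : n, (List.ofFn M).prod s s =
      ∑ σ : Fin (N + 1) → n, (if σ 0 = s then (1 : R) else 0) * pathWt M σ *
        (if σ (Fin.last N) = s then 1 else 0) := by
    intro s
    rw [← sum_mul_listProd_mul_eq M (fun x => if x = s then 1 else 0) (fun x => if x = s then 1 else 0)]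
    simp only [ite_mul, one_mul, zero_mul, mul_ite, mul_one, mul_zero, Finset.sum_ite_eq',
      Finset.mem_univ, if_true]
  simp only [Matrix.trace, Matrix.diag_apply, h]
  rw [Finset.sum_comm]
  refine Finset.sum_congr rfl fun σ _ => ?_
  simp only [ite_mul, one_mul, zero_mul, mul_ite, mul_one, mul_zero]
  rw [Finset.sum_ite_eq]
  simp

end PathSum

/-! ### Substochastic real matrices -/

section SubStoch

variable {n : Type*} [Fintype n] [DecidableEq n]

/-- The set of **substochastic** real matrices: entrywise `≥ 0` with row sums `≤ 1`. [folklore] -/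
def subStoch : Set (Matrix n n ℝ) := {M | (∀ s t, 0 ≤ M s t) ∧ ∀ s, ∑ t, M s t ≤ 1}

omit [DecidableEq n] in
/-- Auxiliary lemma `mem_subStoch_iff` (support step for the results of this file; see the module docstring). -/
theorem mem_subStoch_iff {M : Matrix n n ℝ} :
    M ∈ subStoch ↔ (∀ s t, 0 ≤ M s t) ∧ ∀ s, ∑ t, M s t ≤ 1 := Iff.rfl

omit [DecidableEq n] in
/-- Auxiliary lemma `nonneg_of_mem_subStoch` (support step for the results of this file; see the module docstring). -/
theorem nonneg_of_mem_subStoch {M : Matrix n n ℝ} (hM : M ∈ subStoch) (s t : n) : 0 ≤ M s t :=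
  (mem_subStoch_iff.1 hM).1 s t

omit [DecidableEq n] in
/-- Auxiliary lemma `rowSum_le_of_mem_subStoch` (support step for the results of this file; see the module docstring). -/
theorem rowSum_le_of_mem_subStoch {M : Matrix n n ℝ} (hM : M ∈ subStoch) (s : n) : ∑ t, M s t ≤ 1 :=
  (mem_subStoch_iff.1 hM).2 s

/-- Auxiliary lemma `one_mem_subStoch` (support step for the results of this file; see the module docstring). -/
theorem one_mem_subStoch : (1 : Matrix n n ℝ) ∈ subStoch := by
  refine mem_subStoch_iff.2 ⟨fun s t => ?_, fun s => ?_⟩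
  · rw [Matrix.one_apply]; split_ifs <;> norm_num
  · simp [Matrix.one_apply]

omit [DecidableEq n] in
/-- Auxiliary lemma `mul_mem_subStoch` (support step for the results of this file; see the module docstring). -/
theorem mul_mem_subStoch {A B : Matrix n n ℝ} (hA : A ∈ subStoch) (hB : B ∈ subStoch) :
    A * B ∈ subStoch := by
  refine mem_subStoch_iff.2 ⟨fun s t => ?_, fun s => ?_⟩
  · rw [Matrix.mul_apply]
    exact Finset.sum_nonneg fun r _ =>
      mul_nonneg (nonneg_of_mem_subStoch hA s r) (nonneg_of_mem_subStoch hB r t)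
  · simp only [Matrix.mul_apply]
    rw [Finset.sum_comm]
    calc ∑ r, ∑ t, A s r * B r t = ∑ r, A s r * ∑ t, B r t := by
          simp only [Finset.mul_sum]
      _ ≤ ∑ r, A s r * 1 :=
          Finset.sum_le_sum fun r _ => mul_le_mul_of_nonneg_left (rowSum_le_of_mem_subStoch hB r)
            (nonneg_of_mem_subStoch hA s r)
      _ ≤ 1 := by simpa using rowSum_le_of_mem_subStoch hA s

omit [DecidableEq n] in
/-- Auxiliary lemma `apply_le_one_of_mem_subStoch` (support step for the results of this file; see the module docstring). -/
theorem apply_le_one_of_mem_subStoch {A : Matrix n n ℝ} (hA : A ∈ subStoch) (s t : n) : A s t ≤ 1 :=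
  (Finset.single_le_sum (fun t' _ => nonneg_of_mem_subStoch hA s t') (Finset.mem_univ t)).trans
    (rowSum_le_of_mem_subStoch hA s)

/-- Auxiliary lemma `listProd_mem_subStoch` (support step for the results of this file; see the module docstring). -/
theorem listProd_mem_subStoch {L : List (Matrix n n ℝ)} (hL : ∀ A ∈ L, A ∈ subStoch) :
    L.prod ∈ subStoch := by
  induction L with
  | nil => simpa using one_mem_subStoch
  | cons A L ih =>
    rw [List.prod_cons]
    exact mul_mem_subStoch (hL A (by simp)) (ih fun B hB => hL B (by simp [hB]))

/-- `Tr (D_w M) = Σ_s w_s M_{ss} ≤ Σ_s w_s` for `w ≥ 0` and `M` substochastic. [folklore] -/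
theorem trace_diagonal_mul_le {w : n → ℝ} (hw : ∀ s, 0 ≤ w s) {M : Matrix n n ℝ}
    (hM : M ∈ subStoch) : (diagonal w * M).trace ≤ ∑ s, w s := by
  simp only [Matrix.trace, Matrix.diag_apply, diagonal_mul]
  exact Finset.sum_le_sum fun s _ => by
    simpa using mul_le_mul_of_nonneg_left (apply_le_one_of_mem_subStoch hM s s) (hw s)

/-- **One weighted slot**: if `L[i] = D_w Y` with `Y` substochastic, `w ≥ 0`, and every other
entry of the list `L` is substochastic, then `Tr (∏ L) ≤ Σ_s w_s` (cyclicity of the trace).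
[folklore] -/
theorem trace_listProd_le_of_mem_subStoch (L : List (Matrix n n ℝ)) {i : ℕ} (hi : i < L.length)
    {w : n → ℝ} (hw : ∀ s, 0 ≤ w s) {Y : Matrix n n ℝ} (hY : Y ∈ subStoch)
    (hLi : L[i] = diagonal w * Y)
    (hL : ∀ (j : ℕ) (hj : j < L.length), j ≠ i → L[j] ∈ subStoch) :
    L.prod.trace ≤ ∑ s, w s := by
  have hsplit : L = L.take i ++ (L[i] :: L.drop (i + 1)) := by
    rw [← List.drop_eq_getElem_cons hi, List.take_append_drop]
  have hP : (L.take i).prod ∈ subStoch := by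
    refine listProd_mem_subStoch fun A hA => ?_
    obtain ⟨j, hj, rfl⟩ := List.mem_iff_getElem.1 hA
    rw [List.getElem_take]
    rw [List.length_take] at hj
    exact hL j (by omega) (by omega)
  have hQ : (L.drop (i + 1)).prod ∈ subStoch := by
    refine listProd_mem_subStoch fun A hA => ?_
    obtain ⟨j, hj, rfl⟩ := List.mem_iff_getElem.1 hA
    rw [List.getElem_drop]
    rw [List.length_drop] at hj
    exact hL (i + 1 + j) (by omega) (by omega)
  rw [hsplit, List.prod_append, List.prod_cons, hLi, Matrix.trace_mul_comm, Matrix.mul_assoc,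
    Matrix.mul_assoc]
  exact trace_diagonal_mul_le hw (mul_mem_subStoch hY (mul_mem_subStoch hQ hP))

end SubStoch

/-! ### The AM–GM word bound -/

section WordBound

variable {n : Type*} [Fintype n] [DecidableEq n]

/-- The matrix of entrywise moduli. [folklore] -/
def absEntry (X : Matrix n n ℂ) : Matrix n n ℝ := fun s t => ‖X s t‖

omit [Fintype n] [DecidableEq n] in
/-- Auxiliary lemma `absEntry_apply` (support step for the results of this file; see the module docstring). -/
@[simp] theorem absEntry_apply (X : Matrix n n ℂ) (s t : n) : absEntry X s t = ‖X s t‖ := rfl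

omit [Fintype n] in
/-- Auxiliary lemma `absEntry_one` (support step for the results of this file; see the module docstring). -/
theorem absEntry_one : absEntry (1 : Matrix n n ℂ) = 1 := by
  ext s t
  simp only [absEntry_apply, Matrix.one_apply]
  split_ifs <;> simp

/-- **One slot, path form**: for substochastic moduli and a fixed position `i`,
`Σ_{σ closed} e^{d(σ_i)} ∏_k |X_k(σ_k,σ_{k+1})| ≤ Σ_s e^{d_s}`. [folklore] -/
theorem sum_ite_exp_mul_prod_norm_le {N : ℕ} (d : n → ℝ) (X : Fin N → Matrix n n ℂ)
    (hX : ∀ k, absEntry (X k) ∈ subStoch) (i : Fin N) :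
    ∑ σ : Fin (N + 1) → n, (if σ 0 = σ (Fin.last N) then
        Real.exp (d (σ i.castSucc)) * ∏ k : Fin N, ‖X k (σ k.castSucc) (σ k.succ)‖ else 0) ≤
      ∑ s, Real.exp (d s) := by
  set B : Fin N → Matrix n n ℝ :=
    fun k => diagonal (fun s => if k = i then Real.exp (d s) else 1) * absEntry (X k) with hB
  have hwt : ∀ σ : Fin (N + 1) → n, pathWt B σ =
      Real.exp (d (σ i.castSucc)) * ∏ k : Fin N, ‖X k (σ k.castSucc) (σ k.succ)‖ := by
    intro σ
    simp only [pathWt, hB, diagonal_mul, absEntry_apply]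
    rw [Finset.prod_mul_distrib, Finset.prod_ite_eq']
    simp
  have htr := trace_listProd_ofFn B
  simp only [hwt] at htr
  rw [← htr]
  have hlen : (List.ofFn B).length = N := List.length_ofFn
  refine trace_listProd_le_of_mem_subStoch (List.ofFn B) (i := i.val) (by rw [hlen]; exact i.isLt)
    (w := fun s => Real.exp (d s)) (fun s => (Real.exp_pos _).le) (hX i) ?_ ?_
  · rw [List.getElem_ofFn]
    simp [hB]
  · intro j hj hji
    rw [List.getElem_ofFn]
    have hne : (⟨j, by rwa [hlen] at hj⟩ : Fin N) ≠ i := fun h => hji (by rw [← h])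
    simp only [hB, if_neg hne, diagonal_one, Matrix.one_mul]
    exact hX _

/-- **The AM–GM word bound.** For real `d`, `N ≥ 1` and complex matrices `X₀, …, X_{N-1}` with
substochastic moduli, `|Tr ∏_k (diag(e^{d/N}) X_k)| ≤ Σ_s e^{d_s}`: expand the trace over closed
paths, bound the product of the `N` diagonal weights `∏_k e^{d(σ_k)/N} = e^{(1/N) Σ_k d(σ_k)}` by
Jensen `≤ (1/N) Σ_i e^{d(σ_i)}`, and apply the one-slot bound to each `i`. [folklore; this file] -/
theorem norm_trace_listProd_diagExp_mul_le {N : ℕ} (hN : N ≠ 0) (d : n → ℝ)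
    (X : Fin N → Matrix n n ℂ) (hX : ∀ k, absEntry (X k) ∈ subStoch) :
    ‖((List.ofFn fun k => diagonal (fun s => (Real.exp (d s / N) : ℂ)) * X k).prod).trace‖ ≤
      ∑ s, Real.exp (d s) := by
  have hNpos : (0 : ℝ) < N := by exact_mod_cast Nat.pos_of_ne_zero hN
  rw [trace_listProd_ofFn]
  set c : (Fin (N + 1) → n) → ℝ := fun σ => ∏ k : Fin N, ‖X k (σ k.castSucc) (σ k.succ)‖ with hc
  have hc0 : ∀ σ, 0 ≤ c σ := fun σ => Finset.prod_nonneg fun k _ => norm_nonneg _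
  -- Jensen on each closed path
  have hpath : ∀ σ : Fin (N + 1) → n,
      ‖pathWt (fun k => diagonal (fun s => (Real.exp (d s / N) : ℂ)) * X k) σ‖ ≤
        (∑ i : Fin N, (1 / (N : ℝ)) * Real.exp (d (σ i.castSucc))) * c σ := by
    intro σ
    simp only [pathWt, diagonal_mul, norm_prod, norm_mul, Complex.norm_real, Real.norm_eq_abs,
      abs_of_pos (Real.exp_pos _)]
    rw [Finset.prod_mul_distrib]
    refine mul_le_mul_of_nonneg_right ?_ (hc0 σ)
    rw [← Real.exp_sum]
    have hJ := (convexOn_exp).map_sum_le (t := Finset.univ) (w := fun _ : Fin N => 1 / (N : ℝ))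
      (p := fun i : Fin N => d (σ i.castSucc)) (fun _ _ => by positivity)
      (by rw [Finset.sum_const, Finset.card_univ, Fintype.card_fin, nsmul_eq_mul]; field_simp)
      (fun _ _ => Set.mem_univ _)
    simp only [smul_eq_mul] at hJ
    refine le_of_eq_of_le ?_ hJ
    congr 1
    exact Finset.sum_congr rfl fun i _ => by rw [div_eq_mul_inv, one_div, mul_comm]
  calc ‖∑ σ : Fin (N + 1) → n, if σ 0 = σ (Fin.last N) then
          pathWt (fun k => diagonal (fun s => (Real.exp (d s / N) : ℂ)) * X k) σ else 0‖
      ≤ ∑ σ : Fin (N + 1) → n, ‖if σ 0 = σ (Fin.last N) then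
          pathWt (fun k => diagonal (fun s => (Real.exp (d s / N) : ℂ)) * X k) σ else 0‖ :=
        norm_sum_le _ _
    _ ≤ ∑ σ : Fin (N + 1) → n, if σ 0 = σ (Fin.last N) then
          (∑ i : Fin N, (1 / (N : ℝ)) * Real.exp (d (σ i.castSucc))) * c σ else 0 := by
        refine Finset.sum_le_sum fun σ _ => ?_
        split_ifs
        · exact hpath σ
        · simp
    _ = (1 / (N : ℝ)) * ∑ i : Fin N, ∑ σ : Fin (N + 1) → n, if σ 0 = σ (Fin.last N) then
          Real.exp (d (σ i.castSucc)) * c σ else 0 := by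
        rw [Finset.sum_comm, Finset.mul_sum]
        refine Finset.sum_congr rfl fun σ _ => ?_
        split_ifs
        · rw [Finset.sum_mul, Finset.mul_sum]
          exact Finset.sum_congr rfl fun i _ => by ring
        · simp
    _ ≤ (1 / (N : ℝ)) * ∑ i : Fin N, ∑ s, Real.exp (d s) := by
        refine mul_le_mul_of_nonneg_left (Finset.sum_le_sum fun i _ => ?_) (by positivity)
        exact sum_ite_exp_mul_prod_norm_le d X hX i
    _ = ∑ s, Real.exp (d s) := by
        rw [Finset.sum_const, Finset.card_univ, Fintype.card_fin, nsmul_eq_mul]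
        field_simp

end WordBound

end Summit.HubbardSuperconductivity.HubbardLadder.Bounds
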